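import Summits.BirchSwinnertonDyer.Rank1Residual.Iwasawa.LambdaInvariantZeroSetLayers
import HarnessLib

/-!
# The conductors `p^m` carrying a vanishing cyclotomic twist `L(E, χ, 1) = 0` are few:
# `r + p^{#S} ≤ λ_an + 1` — complex side and instances on tree objects (good ordinary /
# multiplicative `p`; Mazur–Tate elements at any `p`, `μ`-free)
# (cell `b2b-bsdres`; class-agnostic kernel support for the (μ, λ) censuses of iw-1 / iw-2; prover
# unit `b2b-bsdres-additive-p3`, gen 8)

HONEST FRAMING (run/shared/lean/b2b/bsd-rank1-residual/, verbatim in every file): the goal of the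
cell is to DELETE the COMBINATION-SHAPED residual classes of the Birch–Swinnerton-Dyer formula for
ALL analytic-rank `≤ 1` elliptic curves over `ℚ` — "full BSD formula for every rank `≤ 1` curve in
class `C`" assembled STRICTLY from published theorems — so that the rank-`≤ 1` remainder becomes
exactly the CONSTRUCTION-SHAPED classes, which are TYPED (missing-input `Prop`s), NOT attempted.
This is not "finishing BSD". THEOREMS ONLY; no named fact; nothing about any curve is asserted;
nothing booked; no label changes.

## What this file proves

Built on `Iwasawa/LambdaInvariantZeroSet.lean` (λ = number of zeros in the open disc; Galois
orbits) and `Iwasawa/LambdaInvariantZeroSetLayers.lean` (`r + Σ_{n∈S} φ(pⁿ⁺¹) ≤ λ(G)` for the layers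
`S` with a vanishing `ℂ_p`-valued Birch sum), both gen 8:

* §3 (complex side; `f` the newform of `E = W`; Birch's formula is a tree theorem; the gen-6
  transport `ℂ ↝ ℂ_p`): if for every `n` in a finite set `S` some primitive even `p`-power-order
  Dirichlet character `χ` of conductor `p^{n+1+e₀}` has `L(E, χ, 1) = 0` (any entire continuation),
  then `r + Σ_{n ∈ S} φ(pⁿ⁺¹) ≤ λ(G)` and `r + p^{#S} ≤ λ(G) + 1`
  (`add_sum_totient_le_lam_of_twistedLValue_eq_zero`, `add_pow_card_le_lam_succ_of_twistedLValue_eq_zero`),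
  for any `L ∈ ℚ_p⟦T⟧` with the twisted interpolation clause and integral model `ι(G) = ϖ·L`,
  `T^r ∣ G ≠ 0`.
* §4 instances: good ordinary `p` (`L_p(E,T) = padicLFunction f (unitRoot W p)`, interpolation =
  tree theorem `isPAdicLFunctionOf_padicLFunction_holds`; `p^{#S} ≤ λ_an + 1`, and `p^{#S} ≤ λ_an`
  when `ord_{s=1} L(E,s) ≠ 0`), split multiplicative `p` (`p^{#S} ≤ λ_an`: the trivial zero pays),
  multiplicative package `IsMultPAdicLFunctionOf`.
* §5 Mazur–Tate elements (supersingular primes included; `μ`-FREE): for an integral model `Θ ≠ 0`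
  of `θ_n`, `λ(Θ) < φ(pⁿ)` ⇒ every Birch sum and every `L(E, χ, 1)` of conductor `p^{n+e₀}` is
  non-zero (gen 6's `ratTwistedSymbolSum_ne_zero_of_mazurTate`, p217026, WITHOUT its hypothesis
  `μ(Θ) = 0`), and vanishing at conductor `p^{n+e₀}` is a property of the conductor
  (`ratTwistedSymbolSum_eq_zero_iff_of_mazurTate`).

On the iw-1 census (μ = 0; one row per (curve, p); 4 742 rows at good ordinary / multiplicative p)
§4 converts EVERY certified `λ_an` — not only the small values reached by gens 6–7 (2 524 rows with
no vanishing twist at all) — into a bound on the number of conductors with a vanishing twist: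
e.g. `p = 3`, rank one, `λ_an = 8` ⇒ at most two conductors `3^m` (`3^{#S} ≤ 8`).

References: [Washington1997] §7.1–7.2; [MazurTateTeitelbaum1986Invent] §I.8 (8.6), §I.12–I.15;
[MazurSwinnertonDyer1974Invent] §9; [GreenbergLNM1716] §4; HOME/b2b-bsdres-additive-p3/X8-ROUTE-B.md §13.
-/

set_option autoImplicit false

noncomputable section

open scoped Classical MatrixGroups ModularForm

open CongruenceSubgroup Polynomial WeierstrassCurve Literature.NumberTheory.EllipticCurves
  Literature.NumberTheory.EllipticCurves.ModularForms
  Literature.NumberTheory.EllipticCurves.GreenbergVatsal2000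
  Summit.BirchSwinnertonDyer.Rank1Residual.X1.MuLambda
  Summit.BirchSwinnertonDyer.Rank1Residual.X11a
  Summit.BirchSwinnertonDyer.Rank1Residual.Supersingular

namespace Summit.BirchSwinnertonDyer.Rank1Residual.Iwasawa

variable {p : ℕ} [hp : Fact p.Prime]

/-! ## §3. Complex side: the conductors carrying a vanishing twist `L(E, χ, 1) = 0` are few -/

section Complex

variable {N : ℕ} [NeZero N] {f : CuspForm (Gamma0 N) 2} {W : WeierstrassCurve ℚ} [W.IsElliptic]

omit [W.IsElliptic] in
/-- **A vanishing twist `L(f, χ, 1) = 0` (values in `ℂ`) produces a vanishing `ℂ_p`-valued Birch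
sum of the same conductor**: Birch's formula `(∑ χ̄(a)[a/M]⁺)·Ω⁺_f = τ(χ̄)·L(f, χ, 1)` (proved in the
tree) and `Ω⁺_f > 0` give `∑ χ⁻¹(a)[a/M]⁺_f = 0`, and the gen-6 transport `ℂ ↝ ℂ_p` (both descend
to `ℚ(ζ_e)`) turns a vanishing complex sum into a vanishing `ℂ_p`-valued one (contrapositive of
`forall_twistedLValue_ne_zero_of_padic`). [cite: MazurTateTeitelbaum1986Invent, §I.8 (8.6)] -/
theorem exists_padic_ratTwistedSymbolSum_eq_zero_of_twistedLValue_eq_zero (hf : IsNewformOf W f)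
    {M : ℕ} [NeZero M] (χ : DirichletCharacter ℂ M) (hχ : χ.IsPrimitive) (hev : χ.Even)
    (hord : ∃ j : ℕ, orderOf χ = p ^ j) {Lχ : ℂ → ℂ} (hLd : Differentiable ℂ Lχ)
    (hL : ∀ s : ℂ, 2 < s.re → Lχ s = twistedLSeries f χ s) (h1 : Lχ 1 = 0) :
    ∃ χ' : DirichletCharacter ℂ_[p] M, χ'.IsPrimitive ∧ χ'.Even ∧ (∃ j : ℕ, orderOf χ' = p ^ j) ∧
      ratTwistedSymbolSum f χ' = 0 := by
  by_contra h
  push Not at h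
  exact forall_twistedLValue_ne_zero_of_padic (f := f) hf h χ hχ hev hord hLd hL h1

omit [W.IsElliptic] in
/-- **The conductors with a vanishing twist are few.** `f` the newform of `E = W`; `L ∈ ℚ_p⟦T⟧`
with the twisted interpolation clause for `(f, α)`; integral model `ι(G) = ϖ·L`, `T^r ∣ G ≠ 0`. If
for every `n` in a finite set `S` there is a primitive even `p`-power-order Dirichlet character `χ`
of conductor `p^{n+1+e₀}` and an entire continuation `L_χ` of `L(E, χ, s)` with `L_χ(1) = 0`, then
`r + Σ_{n ∈ S} φ(pⁿ⁺¹) ≤ λ(G)`. [cite: MazurTateTeitelbaum1986Invent, §I.8 (8.6) and §I.13–I.14]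
[cite: Washington1997, §7.1–7.2 and Thm. 7.3] -/
theorem add_sum_totient_le_lam_of_twistedLValue_eq_zero (hf : IsNewformOf W f) {α : ℚ_[p]}
    {L : PowerSeries ℚ_[p]}
    (hI : ∀ (m : ℕ), 0 < m → ∀ χ : DirichletCharacter ℂ_[p] (p ^ m), χ.IsPrimitive → χ.Even →
      (∃ j : ℕ, orderOf χ = p ^ j) →
        HasSum (fun k : ℕ ↦ algebraMap ℚ_[p] ℂ_[p] (PowerSeries.coeff k L) *
            (χ (cyclotomicGenerator p : ZMod (p ^ m)) - 1) ^ k)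
          (algebraMap ℚ_[p] ℂ_[p] (α⁻¹ ^ m) * ratTwistedSymbolSum f χ))
    {G : IwasawaAlgebra p} {ϖ : ℚ_[p]} (hG : iwasawaToPowerSeries p G = PowerSeries.C ϖ * L)
    (hG0 : G ≠ 0) {r : ℕ} (hX : (PowerSeries.X : IwasawaAlgebra p) ^ r ∣ G) (S : Finset ℕ)
    (hS : ∀ n ∈ S, ∃ χ : DirichletCharacter ℂ (p ^ (n + 1 + cyclotomicExponent p)),
      χ.IsPrimitive ∧ χ.Even ∧ (∃ j : ℕ, orderOf χ = p ^ j) ∧ ∃ Lχ : ℂ → ℂ, Differentiable ℂ Lχ ∧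
        (∀ s : ℂ, 2 < s.re → Lχ s = twistedLSeries f χ s) ∧ Lχ 1 = 0) :
    r + ∑ n ∈ S, Nat.totient (p ^ (n + 1)) ≤ lam G := by
  refine add_sum_totient_le_lam_of_ratTwistedSymbolSum_eq_zero hI hG hG0 hX S fun n hn ↦ ?_
  obtain ⟨χ, hχ, hev, hord, Lχ, hLd, hL, h1⟩ := hS n hn
  haveI : NeZero (p ^ (n + 1 + cyclotomicExponent p)) := ⟨pow_ne_zero _ hp.out.ne_zero⟩
  exact exists_padic_ratTwistedSymbolSum_eq_zero_of_twistedLValue_eq_zero hf χ hχ hev hord hLd hL h1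

omit [W.IsElliptic] in
/-- **At most `log_p(λ(G) − r + 1)` conductors carry a vanishing twist `L(E, χ, 1) = 0`**:
`r + p^{#S} ≤ λ(G) + 1` under the hypotheses of `add_sum_totient_le_lam_of_twistedLValue_eq_zero`.
[cite: MazurTateTeitelbaum1986Invent, §I.8 (8.6) and §I.13–I.14] [cite: Washington1997, §7.1–7.2 and Thm. 7.3] -/
theorem add_pow_card_le_lam_succ_of_twistedLValue_eq_zero (hf : IsNewformOf W f) {α : ℚ_[p]}
    {L : PowerSeries ℚ_[p]}
    (hI : ∀ (m : ℕ), 0 < m → ∀ χ : DirichletCharacter ℂ_[p] (p ^ m), χ.IsPrimitive → χ.Even →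
      (∃ j : ℕ, orderOf χ = p ^ j) →
        HasSum (fun k : ℕ ↦ algebraMap ℚ_[p] ℂ_[p] (PowerSeries.coeff k L) *
            (χ (cyclotomicGenerator p : ZMod (p ^ m)) - 1) ^ k)
          (algebraMap ℚ_[p] ℂ_[p] (α⁻¹ ^ m) * ratTwistedSymbolSum f χ))
    {G : IwasawaAlgebra p} {ϖ : ℚ_[p]} (hG : iwasawaToPowerSeries p G = PowerSeries.C ϖ * L)
    (hG0 : G ≠ 0) {r : ℕ} (hX : (PowerSeries.X : IwasawaAlgebra p) ^ r ∣ G) (S : Finset ℕ)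
    (hS : ∀ n ∈ S, ∃ χ : DirichletCharacter ℂ (p ^ (n + 1 + cyclotomicExponent p)),
      χ.IsPrimitive ∧ χ.Even ∧ (∃ j : ℕ, orderOf χ = p ^ j) ∧ ∃ Lχ : ℂ → ℂ, Differentiable ℂ Lχ ∧
        (∀ s : ℂ, 2 < s.re → Lχ s = twistedLSeries f χ s) ∧ Lχ 1 = 0) :
    r + p ^ S.card ≤ lam G + 1 := by
  have h1 := add_sum_totient_le_lam_of_twistedLValue_eq_zero hf hI hG hG0 hX S hS
  have h2 := pow_card_le_one_add_sum_totient (p := p) S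
  omega

end Complex

/-! ## §4. Instances on tree objects: good ordinary, split multiplicative, multiplicative package -/

section Instances

variable {N : ℕ} [NeZero N] {f : CuspForm (Gamma0 N) 2} {W : WeierstrassCurve ℚ} [W.IsElliptic]
  [W.IsGloballyMinimal]

/-- **Good ordinary `p`: the conductors with a vanishing twist are few.** `L_p(E,T) =
padicLFunction f (unitRoot W p)` (interpolation = tree theorem `isPAdicLFunctionOf_padicLFunction_holds`),
`G` any integral model `ι(G) = ϖ·L_p(E,T)`, `G ≠ 0`: `p^{#S} ≤ λ(G) + 1` for every finite set `S` of
layers `n` carrying a character of conductor `p^{n+1+e₀}` with `L(E, χ, 1) = 0` (any analytic rank).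
[cite: MazurSwinnertonDyer1974Invent, §9] [cite: MazurTateTeitelbaum1986Invent, §I.14 (14.3)] -/
theorem ordinary_pow_card_le_lam_succ_of_twistedLValue_eq_zero (hord : IsOrdinaryAt W p)
    (hf : IsNewformOf W f) {G : IwasawaAlgebra p} {ϖ : ℚ_[p]}
    (hG : iwasawaToPowerSeries p G = PowerSeries.C ϖ * padicLFunction f (unitRoot W p : ℚ_[p]))
    (hG0 : G ≠ 0) (S : Finset ℕ)
    (hS : ∀ n ∈ S, ∃ χ : DirichletCharacter ℂ (p ^ (n + 1 + cyclotomicExponent p)),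
      χ.IsPrimitive ∧ χ.Even ∧ (∃ j : ℕ, orderOf χ = p ^ j) ∧ ∃ Lχ : ℂ → ℂ, Differentiable ℂ Lχ ∧
        (∀ s : ℂ, 2 < s.re → Lχ s = twistedLSeries f χ s) ∧ Lχ 1 = 0) :
    p ^ S.card ≤ lam G + 1 := by
  have h := add_pow_card_le_lam_succ_of_twistedLValue_eq_zero hf
    (isPAdicLFunctionOf_padicLFunction_holds hord hf).2 hG hG0 (r := 0) (by rw [pow_zero]; exact one_dvd _) S hS
  simpa using h

/-- **Good ordinary `p`, `ord_{s=1} L(E,s) ≠ 0`: `p^{#S} ≤ λ(G)`** (the zero at `T = 0` pays one unit: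
`L_p(E,0) = (1 − α⁻¹)²·L(E,1)/Ω⁺ = 0`). E.g. `p = 3`, rank one, `λ_an = 8`: at most two conductors
`3^m` carry a vanishing twist. [cite: MazurSwinnertonDyer1974Invent, §9] [cite: MazurTateTeitelbaum1986Invent, §I.14 (14.3)] -/
theorem ordinary_pow_card_le_lam_of_twistedLValue_eq_zero_of_analyticRank_ne_zero
    (hord : IsOrdinaryAt W p) (hf : IsNewformOf W f) (hr : W.analyticRank ≠ 0)
    {G : IwasawaAlgebra p} {ϖ : ℚ_[p]}
    (hG : iwasawaToPowerSeries p G = PowerSeries.C ϖ * padicLFunction f (unitRoot W p : ℚ_[p]))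
    (hG0 : G ≠ 0) (S : Finset ℕ)
    (hS : ∀ n ∈ S, ∃ χ : DirichletCharacter ℂ (p ^ (n + 1 + cyclotomicExponent p)),
      χ.IsPrimitive ∧ χ.Even ∧ (∃ j : ℕ, orderOf χ = p ^ j) ∧ ∃ Lχ : ℂ → ℂ, Differentiable ℂ Lχ ∧
        (∀ s : ℂ, 2 < s.re → Lχ s = twistedLSeries f χ s) ∧ Lχ 1 = 0) :
    p ^ S.card ≤ lam G := by
  have h := add_pow_card_le_lam_succ_of_twistedLValue_eq_zero hf
    (isPAdicLFunctionOf_padicLFunction_holds hord hf).2 hG hG0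
    (ordinary_X_dvd_of_entireLFunction_one_eq_zero hord hf
      (apply_eq_zero_of_analyticOrderNatAt_ne_zero (f := W.entireLFunction) hr) hG) S hS
  omega

omit [W.IsGloballyMinimal] [W.IsElliptic] in
/-- **Split multiplicative `p`: `p^{#S} ≤ λ(G)`** for the integral models of THE function of
`IsSplitMultPAdicLFunctionOf f p L` (the trivial zero pays one unit of `λ`; any analytic rank).
[cite: MazurTateTeitelbaum1986Invent, §I.14 (14.3) and §I.15] -/
theorem splitMult_pow_card_le_lam_of_twistedLValue_eq_zero (hf : IsNewformOf W f)
    {L : PowerSeries ℚ_[p]} (hL : IsSplitMultPAdicLFunctionOf f p L) {G : IwasawaAlgebra p}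
    {ϖ : ℚ_[p]} (hG : iwasawaToPowerSeries p G = PowerSeries.C ϖ * L) (hG0 : G ≠ 0) (S : Finset ℕ)
    (hS : ∀ n ∈ S, ∃ χ : DirichletCharacter ℂ (p ^ (n + 1 + cyclotomicExponent p)),
      χ.IsPrimitive ∧ χ.Even ∧ (∃ j : ℕ, orderOf χ = p ^ j) ∧ ∃ Lχ : ℂ → ℂ, Differentiable ℂ Lχ ∧
        (∀ s : ℂ, 2 < s.re → Lχ s = twistedLSeries f χ s) ∧ Lχ 1 = 0) :
    p ^ S.card ≤ lam G := by
  have h := add_pow_card_le_lam_succ_of_twistedLValue_eq_zero hf hL.2.2 hG hG0 (splitMult_X_dvd hL hG)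
    S hS
  omega

omit [W.IsGloballyMinimal] [W.IsElliptic] in
/-- **Multiplicative `p` (package `IsMultPAdicLFunctionOf f p ε L`): `p^{#S} ≤ λ(G) + 1`**, and
`p^{#S} ≤ λ(G)` when `L(E, 1) = 0`. [cite: MazurTateTeitelbaum1986Invent, §I.14 (14.3) and §I.15]
[cite: GreenbergLNM1716, §4 (PDF p. 113)] -/
theorem mult_pow_card_le_lam_succ_of_twistedLValue_eq_zero (hf : IsNewformOf W f) {ε : ℚ_[p]}
    {L : PowerSeries ℚ_[p]} (hL : IsMultPAdicLFunctionOf f p ε L) {G : IwasawaAlgebra p}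
    {ϖ : ℚ_[p]} (hG : iwasawaToPowerSeries p G = PowerSeries.C ϖ * L) (hG0 : G ≠ 0) (S : Finset ℕ)
    (hS : ∀ n ∈ S, ∃ χ : DirichletCharacter ℂ (p ^ (n + 1 + cyclotomicExponent p)),
      χ.IsPrimitive ∧ χ.Even ∧ (∃ j : ℕ, orderOf χ = p ^ j) ∧ ∃ Lχ : ℂ → ℂ, Differentiable ℂ Lχ ∧
        (∀ s : ℂ, 2 < s.re → Lχ s = twistedLSeries f χ s) ∧ Lχ 1 = 0) :
    p ^ S.card ≤ lam G + 1 ∧ (W.entireLFunction 1 = 0 → p ^ S.card ≤ lam G) := by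
  refine ⟨?_, fun hL1 ↦ ?_⟩
  · have h := add_pow_card_le_lam_succ_of_twistedLValue_eq_zero hf hL.2.2 hG hG0 (r := 0)
      (by rw [pow_zero]; exact one_dvd _) S hS
    simpa using h
  · have h := add_pow_card_le_lam_succ_of_twistedLValue_eq_zero hf hL.2.2 hG hG0
      (X_dvd_of_constantCoeff_eq_zero (by
        rw [hL.2.1, ratPlusSymbol_zero_eq_zero_of_entireLFunction_eq_zero hf hL1, Rat.cast_zero,
          mul_zero]) hG) S hS
    omega

end Instances

/-! ## §5. Mazur–Tate elements (any prime, supersingular included): `μ`-free single-layer forms -/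

section MazurTate

variable {N : ℕ} [NeZero N] {f : CuspForm (Gamma0 N) 2} {W : WeierstrassCurve ℚ} [W.IsElliptic]

omit [NeZero N] in
/-- **An integral model of `θ_n` evaluates to the Birch sums of conductor `p^{n+e₀}`**: if
`Θ ∈ Λ` has `ι(Θ) = θ_n` (the Mazur–Tate element, tree `mazurTateElement f p n`), then for every
even `p`-power-order `χ` mod `p^{n+e₀}` with values in `ℂ_p`,
`∑_k Θ_k (χ(γ) − 1)^k = ∑_a χ(a)[a/p^{n+e₀}]⁺_f` (`eval₂_mazurTateElement_eq_ratTwistedSymbolSum`).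
[cite: MazurTateTeitelbaum1986Invent, §I.8 and §I.12] -/
theorem hasSum_mazurTate_eq_ratTwistedSymbolSum {n : ℕ} {Θ : IwasawaAlgebra p}
    (hΘ : iwasawaToPowerSeries p Θ =
      ((mazurTateElement f p n).map (algebraMap ℚ ℚ_[p]) : PowerSeries ℚ_[p]))
    (χ : DirichletCharacter ℂ_[p] (p ^ (n + cyclotomicExponent p))) (hev : χ.Even)
    (hord : ∃ j : ℕ, orderOf χ = p ^ j) :
    HasSum (fun k ↦ ((algebraMap ℚ_[p] ℂ_[p]).comp (algebraMap ℤ_[p] ℚ_[p]))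
        (PowerSeries.coeff k Θ) * (χ (cyclotomicGenerator p : ZMod (p ^ (n + cyclotomicExponent p))) - 1) ^ k)
      (ratTwistedSymbolSum f χ) := by
  set z : ℂ_[p] := χ (cyclotomicGenerator p : ZMod (p ^ (n + cyclotomicExponent p))) - 1 with hz
  have h := hasSum_map_coeff_coe_mul_pow (algebraMap ℚ ℂ_[p]) (mazurTateElement f p n) z
  rw [eval₂_mazurTateElement_eq_ratTwistedSymbolSum f χ hev hord] at h
  refine h.congr_fun fun k ↦ ?_
  have hk : algebraMap ℤ_[p] ℚ_[p] (PowerSeries.coeff k Θ) =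
      algebraMap ℚ ℚ_[p] ((mazurTateElement f p n).coeff k) := by
    have h1 := congr_arg (PowerSeries.coeff k) hΘ
    rw [iwasawaToPowerSeries, PowerSeries.coeff_map, Polynomial.coeff_coe, Polynomial.coeff_map] at h1
    exact h1
  show ((algebraMap ℚ_[p] ℂ_[p]).comp (algebraMap ℤ_[p] ℚ_[p])) (PowerSeries.coeff k Θ) * z ^ k =
    algebraMap ℚ ℂ_[p] (PowerSeries.coeff k (mazurTateElement f p n : PowerSeries ℚ)) * z ^ k
  rw [Polynomial.coeff_coe, RingHom.comp_apply, hk]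
  congr 1
  simp only [eq_ratCast, map_ratCast]

omit [NeZero N] in
/-- **`μ`-free Mazur–Tate single-layer theorem**: `Θ ≠ 0` an integral model of `θ_n` (`n ≥ 1`) with
`λ(Θ) < φ(pⁿ)` ⇒ `∑_a χ(a)[a/p^{n+e₀}]⁺_f ≠ 0` for every primitive even `p`-power-order `χ` of
conductor `p^{n+e₀}` — gen 6's `ratTwistedSymbolSum_ne_zero_of_mazurTate` (p217026) WITHOUT the
hypothesis `μ(Θ) = 0` (a zero at `χ(γ) − 1`, of order `pⁿ`, would cost `φ(pⁿ)` of `λ(Θ)`, p220367).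
[cite: MazurTateTeitelbaum1986Invent, §I.8 and §I.12] [cite: Washington1997, §7.1–7.2 and Thm. 7.3] -/
theorem ratTwistedSymbolSum_ne_zero_of_mazurTate_lam_lt {n : ℕ} (hn : 0 < n) {Θ : IwasawaAlgebra p}
    (hΘ : iwasawaToPowerSeries p Θ =
      ((mazurTateElement f p n).map (algebraMap ℚ ℚ_[p]) : PowerSeries ℚ_[p]))
    (hΘ0 : Θ ≠ 0) (hlam : lam Θ < Nat.totient (p ^ n))
    (χ : DirichletCharacter ℂ_[p] (p ^ (n + cyclotomicExponent p))) (hχ : χ.IsPrimitive)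
    (hev : χ.Even) (hord : ∃ j : ℕ, orderOf χ = p ^ j) :
    ratTwistedSymbolSum f χ ≠ 0 := by
  obtain ⟨k, rfl⟩ := Nat.exists_eq_succ_of_ne_zero hn.ne'
  intro h0
  have hsum := hasSum_mazurTate_eq_ratTwistedSymbolSum hΘ χ hev hord
  rw [h0] at hsum
  have hζ := isPrimitiveRoot_apply_cyclotomicGenerator χ hχ hev hord
  exact absurd hlam (not_lt.mpr (totient_le_lam_of_hasSum_zero hΘ0 hζ hsum))

omit [NeZero N] in
/-- **Vanishing of the Birch sums of conductor `p^{n+e₀}` is a property of the conductor**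
(Mazur–Tate form, any integral model `Θ` of `θ_n`, `n ≥ 1`): for two primitive even `p`-power-order
characters `χ, χ'` mod `p^{n+e₀}`, `∑ χ(a)[a/p^{n+e₀}]⁺_f = 0 ↔ ∑ χ'(a)[a/p^{n+e₀}]⁺_f = 0`.
[cite: MazurTateTeitelbaum1986Invent, §I.8 and §I.12] [cite: Washington1997, §7.1–7.2 and Thm. 7.3] -/
theorem ratTwistedSymbolSum_eq_zero_iff_of_mazurTate {n : ℕ} (hn : 0 < n) {Θ : IwasawaAlgebra p}
    (hΘ : iwasawaToPowerSeries p Θ =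
      ((mazurTateElement f p n).map (algebraMap ℚ ℚ_[p]) : PowerSeries ℚ_[p]))
    {χ χ' : DirichletCharacter ℂ_[p] (p ^ (n + cyclotomicExponent p))} (hχ : χ.IsPrimitive)
    (hev : χ.Even) (hord : ∃ j : ℕ, orderOf χ = p ^ j) (hχ' : χ'.IsPrimitive) (hev' : χ'.Even)
    (hord' : ∃ j : ℕ, orderOf χ' = p ^ j) :
    ratTwistedSymbolSum f χ = 0 ↔ ratTwistedSymbolSum f χ' = 0 := by
  obtain ⟨k, rfl⟩ := Nat.exists_eq_succ_of_ne_zero hn.ne'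
  have hsum := hasSum_mazurTate_eq_ratTwistedSymbolSum hΘ χ hev hord
  have hsum' := hasSum_mazurTate_eq_ratTwistedSymbolSum hΘ χ' hev' hord'
  have hζ := isPrimitiveRoot_apply_cyclotomicGenerator χ hχ hev hord
  have hζ' := isPrimitiveRoot_apply_cyclotomicGenerator χ' hχ' hev' hord'
  constructor
  · intro h0
    rw [h0] at hsum
    exact hsum'.unique ((hasSum_zero_iff_of_isPrimitiveRoot Θ hζ hζ').mp hsum)
  · intro h0
    rw [h0] at hsum'
    exact hsum.unique ((hasSum_zero_iff_of_isPrimitiveRoot Θ hζ' hζ).mp hsum')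

omit [W.IsElliptic] in
/-- **`μ`-free Mazur–Tate single-layer theorem, complex side**: `Θ ≠ 0` an integral model of
`θ_n`, `n ≥ 1`, `λ(Θ) < φ(pⁿ)`, `f` the newform of `E = W` ⇒ `L(E, χ, 1) ≠ 0` for every primitive
even `p`-power-order `χ` of conductor `p^{n+e₀}` and every entire continuation.
[cite: MazurTateTeitelbaum1986Invent, §I.8 (8.6) and §I.12] [cite: Washington1997, §7.1–7.2 and Thm. 7.3] -/
theorem twistedLValue_ne_zero_of_mazurTate_lam_lt (hf : IsNewformOf W f) {n : ℕ} (hn : 0 < n)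
    {Θ : IwasawaAlgebra p}
    (hΘ : iwasawaToPowerSeries p Θ =
      ((mazurTateElement f p n).map (algebraMap ℚ ℚ_[p]) : PowerSeries ℚ_[p]))
    (hΘ0 : Θ ≠ 0) (hlam : lam Θ < Nat.totient (p ^ n))
    (χ : DirichletCharacter ℂ (p ^ (n + cyclotomicExponent p))) (hχ : χ.IsPrimitive) (hev : χ.Even)
    (hord : ∃ j : ℕ, orderOf χ = p ^ j) {Lχ : ℂ → ℂ} (hLd : Differentiable ℂ Lχ)
    (hLχ : ∀ s : ℂ, 2 < s.re → Lχ s = twistedLSeries f χ s) : Lχ 1 ≠ 0 := by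
  haveI : NeZero (p ^ (n + cyclotomicExponent p)) := ⟨pow_ne_zero _ hp.out.ne_zero⟩
  exact forall_twistedLValue_ne_zero_of_padic (f := f) hf
    (fun χ' hχ' hev' hord' ↦ ratTwistedSymbolSum_ne_zero_of_mazurTate_lam_lt hn hΘ hΘ0 hlam χ' hχ'
      hev' hord') χ hχ hev hord hLd hLχ

end MazurTate

end Summit.BirchSwinnertonDyer.Rank1Residual.Iwasawa

end
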